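import Summits.QuantumFields.YangMills.Theorems.BalabanUVNodesN11Sect3SupplyChainBorelBThm1PrintedOfSolvable
import Summits.QuantumFields.YangMills.Theorems.BalabanUVNodesN11NoExpansionNumerics
import Summits.QuantumFields.YangMills.Theorems.BalabanUVNodesN11CubeCoverRowOfNesting

/-!
# DAG node N11 — BOREL 𝐁-TERMS ALONG THE WITNESS CHAIN, VI: N11's `SupplierBorel` road with the FIVE NUMERIC ROWS AND THE CUBE COVER DISCHARGED TO SCALARS —
# `NoExpansionObligation` ∕ `SupplyChainAt` ∕ THEOREM 1 ∕ `B16.Thm1Printed` from the key, the live line, SEVEN SCALAR LETTERS of `(θ.ν, L, θ.γ, N)` + the nesting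
# `L·M₂ ∣ M`, and per windowed run ONLY `PartCompat₁₃`, K0's per-cube [15]-solvability and [III] §3's supplier

HEADER — WORK-UNIT METADATA.  Cell `pub-ymgap`, YM-PLAN Track A (D-0062 ∕ D-0149 width seats), seat `pub-ymgap-dag-n11-w1` (g2; WIDTH SEAT 1 of 4 on NODE n11 [B14]),
route `BalabanUVNodes` rev 25, item K1⁷ `StabilityBAtRecordR13SepCoPH` = stmt-QuantumFields-20542 (helper, `--kind proof --supports 20542 --as helper`, count-neutral).
[III] = [Balaban1988Convergent], [15] = [Balaban1985Variational], [B7] = [Balaban1985Averaging], [B16] = [Balaban1989LargeFieldII].  Over this seat's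
`…N11Sect3SupplyChainBorelBObligationsOfSolvable` ∕ `…BorelBThm1PrintedOfSolvable` (the road re-keyed on dag-n11-d's ZhPin face: rows `h3 hR hε hε3 hε2 hsolv hcov`),
dag-n11-w3 g3's `…N11NoExpansionNumerics` (★★ `h3_of_scalars` ∕ `hR_of_scalars` ∕ `hε_of_window` ∕ `hε3_of_window` ∕ `hε2_of_window`: the five numeric rows from scalars on
`(θ.ν, L, θ.γ)` and the window) and dag-n11-w4 g3's `…N11CubeCoverRowOfNesting` (★★ `cover_row_of_partCompat_of_nesting`: the cube-cover row from `PartCompat₁₃` and the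
nesting numeric `L·M₂ ∣ M`).  Consumed BY NAME; nothing re-typed.

WHY THIS FILE.  After FILES IV∕V the `SupplierBorel` road displayed, per level `1 ≤ j ≤ K`, the five numeric rows of dag-n11-d's letters and the cube cover.  dag-n11-w3 and
dag-n11-w4 reduced them to SCALARS: `3·M₁ ≤ L·M₂`, `(d+4)·L + 3 ≤ L·M₂` (d = 4), `0 < A₀`, `θ.γ < 1`, `θ.γ ≤ e^{−p₀}` with the two (2.4)-profile inequalities at the
window's edge `ε(θ.γ) := θ.γ·A₀·(log θ.γ⁻²)^{p₀}` (`143·(8²∕4)²·ε(θ.γ) ≤ 1∕3`, `2ε(θ.γ) ≤ 2δ_N∕(8L)²`), and `L·M₂ ∣ M` + `PartCompat₁₃`.  This file folds both into the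
chain-level faces: what a windowed run must still bring is `PartCompat₁₃` up to `K`, K0's per-cube [15]-solvability inside `χ_j` (levels `1…K`) and the supplier.

WHAT THIS FILE PROVES (6 theorems, 0 `sorry`, 0 `def`; nothing of Bałaban asserted).
§6 ★★★ `noExpansionObligation_of_gaussCert_of_supplierBorel_of_nesting_of_scalars` ∕ ★★★ `supplyChainAt_of_gaussCert_of_supplierBorel_of_nesting_of_scalars` ∕ ★★★★
   `sLaw₁₃CoPH_all_of_obligations_of_gaussCert_of_supplierBorel_of_nesting_of_scalars` (generic Gaussian-class `θ` with the separated-range key; run-level) ∕ ★★★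
   `supplyChainAt_gaussPinH_of_supplierBorel_of_nesting_of_scalars` (the NAMED certificate).
§7 ★★★★ `thm1Printed_datumOfRecord₁₃SepCoPH_of_gaussCert_of_supplierBorel_of_nesting_of_scalars` ∕ ★★★★★
   `thm1Printed_datumOfRecord₁₃SepCoPH_gaussPinH_of_supplierBorel_of_nesting_of_scalars` — N11's PRINTED OUTPUT at the K1⁷-keyed datum (of `θ` ∕ of `gaussPinH θ`) from:
   the key `Provisos₁₃SepCoPH θ`, the live-selector line (selector clause, admissibility, three signs), the θ-level letters `0 < M₁ ≤ M`, `2 ≤ cR`, `L·M₂ ∣ M`,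
   `3·M₁ ≤ L·M₂`, `8L + 3 ≤ L·M₂`, `0 < A₀`, `θ.γ < 1`, `θ.γ ≤ e^{−p₀}`, the two edge inequalities; SOME `γ > 0`; and PER RUN IN `]0, γ]`: `PartCompat₁₃` up to `K`,
   K0's per-cube [15]-solvability (levels `1…K`), [III] §3's supplier with `SupplierObligations` + `SupplierBorel`.  THE HONEST STATE OF N11 ON THIS ROAD.

HONEST FRAMING.  Helper lane of K1⁷; composition by name; nothing of [III] ∕ [15] ∕ [B7] ∕ [B16] asserted — per-cube solvability, `PartCompat₁₃`, `Provisos₁₃SepCoPH`, the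
scalars and the supplier are HYPOTHESES.  LOCATED (A6): at K1's witness of record θ₁₅ᶜᶜᴹᵂ(j; γ) every scalar here is a window letter or `rfl` (`M₂ = 1`, `M = M₁ = L^j`:
dag-n11-w3 INTENT-4, dag-n11-w4 `nesting_theta13OfThm1CCMW`) EXCEPT `2 ≤ cR` — `cR = 1` there and at `theta13LiveOfRecord` (dag-n11-d LOCATED g12); no record edition is
offered and joint inhabitation of the displayed rows at one θ is NOT in the tree.  N11 NOT discharged; K1⁷ NOT closed; counts unmoved (typed 28∕28 · discharged 5∕27).  R4
closes only the conditional finite-𝕋⁴ rung `BalabanLadder.UV` of one programme at fixed `ε = L^{−K}` — NOT ℝ⁴, NOT OS, NOT a mass gap, NOT Clay.  No `sorry`, `axiom`, `def`,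
`instance`, `notation`.  Sources (SHAPE only): [III] Thm 1 p.262, Theorem p.245, §3 p.279, (2.1) p.254, (2.4)–(2.5) p.255, (2.13) pp.256–257, (2.16)–(2.18) p.257,
(3.24)–(3.25) p.270, (0.2) p.244; [15] Thm 1 (7)–(8) pp.278–279; [B7] Prop. 2 p.26; [B16] Thm 1 p.355; [Balaban1987RG1] Thm 1 p.259; [Balaban1989LargeFieldI] (0.3)–(0.4) p.176.
-/

noncomputable section

open MeasureTheory
open scoped BigOperators ENNReal NNReal Matrix.Norms.L2Operator

namespace Summit.QuantumFields.YangMills.Theorems.BalabanUVNodesN11Sect3SupplyChainBorelBThm1PrintedOfScalars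

open Literature.MathematicalPhysics.QuantumFieldTheory.Balaban1983to89 T4Continuum T4NestedCovariance Node00 Node00.Tk DagBinding
open B15DeterminingSets B8Eq17ClassAkV1 B14.Eq218Concrete B10Eq42TorusConstraint Step
open B14.Eq213MaximalDomains (side)
open B14.Eq213DetSet (Bj)
open Literature.MathematicalPhysics.QuantumFieldTheory.BalabanImbrieJaffe1984to88.BIJ85Eq453GaugeField (qsstarGIter0)
open BalabanUVNodesN11HistoryPinnedResidualDefs BalabanUVNodesN11RePinnedParamDefs
open BalabanUVNodesN11GaussianCertificateRows
open BalabanUVNodesN11GaussianCertificateDefs (gaussPinH gaussPinH_ζ0 gaussPinH_quad provisos₁₃CoPH_gaussPinH)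
open BalabanUVNodesN11Sect3SupplyChainDefs
open BalabanUVNodesN11Sect3SupplyChainBorelB
open BalabanUVNodesN11Sect3SupplyChainObligationsDefs
open BalabanUVNodesN11Sect3SupplyChainNode (thm1Printed_datumOfRecord₁₃CoPH_of_obligations)
open BalabanUVNodesN11Sect3SupplyChainBorelBObligationsOfSolvable
open BalabanUVNodesN11Sect3SupplyChainBorelBThm1PrintedOfSolvable
open BalabanUVNodesN11NoExpansionNumerics (h3_of_scalars hR_of_scalars hε_of_window hε3_of_window hε2_of_window)
open BalabanUVNodesN11CubeCoverRowOfNesting (cover_row_of_partCompat_of_nesting)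

variable {F : T4Family} {N : ℕ} [NeZero N]

/-! ## §6  The run-level faces with the five numeric rows and the cube cover discharged to scalars -/

section RunLevel

variable (θ : Stage13HParams F N) (p : B12.RunParams)

/-- **★★★ `NoExpansionObligation θ p σ` AT A GAUSSIAN CERTIFICATE FROM SCALARS, `PartCompat₁₃`, K0's SOLVABILITY AND `SupplierBorel`** — FILE IV §3 with dag-n11-d's five
numeric rows supplied by dag-n11-w3's `h3_of_scalars` ∕ `hR_of_scalars` ∕ `hε_of_window` ∕ `hε3_of_window` ∕ `hε2_of_window` (`3·M₁ ≤ L·M₂`, `8L + 3 ≤ L·M₂`, `0 < A₀`,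
`θ.γ < 1`, `θ.γ ≤ e^{−p₀}`, the two inequalities at the window's edge) and the cube-cover row by dag-n11-w4's `cover_row_of_partCompat_of_nesting` (`L·M₂ ∣ M` + the run's
`PartCompat₁₃`).  `d = 4`, `(F.P p.K).L = L` (`rfl`). [cite: Balaban1988Convergent, Theorem p.245, Thm 1 p.262, §3 p.279, (2.1) p.254, (2.4)–(2.5) p.255, (2.13) pp.256–257, (2.16)–(2.18) p.257, (3.24)–(3.25) p.270; Balaban1985Variational, Thm 1 (7)–(8) pp.278–279; Balaban1985Averaging, Prop. 2 p.26] -/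
theorem noExpansionObligation_of_gaussCert_of_supplierBorel_of_nesting_of_scalars
    (hζ : ∀ (p' : B12.RunParams) (n : ℕ) (Ω Λ : ℕ → Set (Site (F.P p'.K) 0)), (θ.Zh p' n Ω Λ).ζ0 = (ZhPinOfRecord₁₃ θ.toStage13Params p' Ω Λ).ζ0)
    (hq : ∀ (p' : B12.RunParams) (n : ℕ) (Ω Λ : ℕ → Set (Site (F.P p'.K) 0)) (j : ℕ) (Λ' : Set (Site (F.P p'.K) 0)) (ω : MultiCfg (F.P p'.K) (SU N) (FluctV N)),
      (θ.Zh p' n Ω Λ).quad j Λ' ω = ∑ b ∈ (Set.toFinite (bondsIn j (Λ'ᶜ ∩ Ω (j + 1)))).toFinset, ‖(ω j).2 b‖ ^ 2)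
    (h : θ.Provisos₁₃SepCoPH F N) (hθ : θ.Admissible F N) (hM₁ : 0 < θ.ν.M₁) (hle : θ.ν.M₁ ≤ θ.τ9.M) (hcR : 2 ≤ θ.s2.cR)
    (hdiv : F.L * θ.ν.M₂ ∣ θ.τ9.M) (hM3 : 3 * θ.ν.M₁ ≤ F.L * θ.ν.M₂) (hMd : 8 * F.L + 3 ≤ F.L * θ.ν.M₂)
    (hA : 0 < θ.ν.A₀) (hγ1 : θ.γ < 1) (hγp : θ.γ ≤ Real.exp (-(θ.ν.p₀ : ℝ)))
    (hg3 : (143 * ((((8 : ℕ) : ℝ)) ^ 2 / 4) ^ 2) * (θ.γ * (θ.ν.A₀ * (Real.log (θ.γ ^ 2)⁻¹) ^ θ.ν.p₀)) ≤ 1 / 3)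
    (hg2 : 2 * (θ.γ * (θ.ν.A₀ * (Real.log (θ.γ ^ 2)⁻¹) ^ θ.ν.p₀)) ≤ 2 * ExpMeanLog.deltaSU (Fin N) / (((8 * F.L : ℕ) : ℝ)) ^ 2)
    (hw : Step.InInterval θ.γ p.K (gOfRecord₁₃ F N θ.toStage13Params p)) (hPC : PartCompat₁₃ F N θ.toStage13Params p p.K)
    (hsolv : ∀ j, 1 ≤ j → j ≤ p.K → ∀ (s : SeqOfRecord F θ.ν θ.τ9.M (gOfRecord₁₃ F N θ.toStage13Params p) p.K j) (V : GaugeField (F.P p.K) j (SU N)),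
      chiSeqOfRecord F N θ.ν θ.τ9.M (gOfRecord₁₃ F N θ.toStage13Params p) p.K j s V ≠ 0 →
      ∀ a ∈ cubesIn (fun a : ↥(cubeIndices (F.P p.K) (cubeSide (F.P p.K).L θ.ν.M₂ (RkOfRecord (F.P p.K).L θ.ν.r (gOfRecord₁₃ F N θ.toStage13Params p j)) j)) =>
          cubeEnl (F.P p.K) (cubeSide (F.P p.K).L θ.ν.M₂ (RkOfRecord (F.P p.K).L θ.ν.r (gOfRecord₁₃ F N θ.toStage13Params p j)) j) a 0) (s.Ω j),
        ∃ U₀, IsMinimizer (avOfRecord F N p.K) {U | PlaqSmall (θ.ν.εreg * (F.P p.K).eta j ^ 2) U}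
          (Bj θ.ν.M₁ (cubeEnl (F.P p.K) (cubeSide (F.P p.K).L θ.ν.M₂ (RkOfRecord (F.P p.K).L θ.ν.r (gOfRecord₁₃ F N θ.toStage13Params p j)) j) a 4) j)
          (avgFamily (avOfRecord F N p.K) (qsstarGIter0 j V)) U₀)
    (σ : Sect3Supplier θ p) (hσB : SupplierBorel θ p σ) : NoExpansionObligation θ p σ :=
  noExpansionObligation_of_gaussCert_of_supplierBorel_of_solvable θ p hζ hq h hθ hM₁ hle hcR hw hPC (h3_of_scalars θ p hM3 p.K) (hR_of_scalars θ p hMd p.K) (hε_of_window θ p hA hγ1 hw)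
    (hε3_of_window θ p hA hγp hw hg3) (hε2_of_window θ p hA hγp hw hg2) hsolv (cover_row_of_partCompat_of_nesting θ p hdiv hPC)
    σ hσB

/-- **★★★ N11's ONE-TOKEN RESIDUAL `SupplyChainAt θ p` AT A GAUSSIAN CERTIFICATE FROM SCALARS, `PartCompat₁₃`, K0's SOLVABILITY AND THE SUPPLIER** (`SupplierObligations` +
`SupplierBorel`). [cite: Balaban1988Convergent, Thm 1 p.262, Theorem p.245, §3 p.279, (3.24)–(3.25) p.270] -/
theorem supplyChainAt_of_gaussCert_of_supplierBorel_of_nesting_of_scalars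
    (hζ : ∀ (p' : B12.RunParams) (n : ℕ) (Ω Λ : ℕ → Set (Site (F.P p'.K) 0)), (θ.Zh p' n Ω Λ).ζ0 = (ZhPinOfRecord₁₃ θ.toStage13Params p' Ω Λ).ζ0)
    (hq : ∀ (p' : B12.RunParams) (n : ℕ) (Ω Λ : ℕ → Set (Site (F.P p'.K) 0)) (j : ℕ) (Λ' : Set (Site (F.P p'.K) 0)) (ω : MultiCfg (F.P p'.K) (SU N) (FluctV N)),
      (θ.Zh p' n Ω Λ).quad j Λ' ω = ∑ b ∈ (Set.toFinite (bondsIn j (Λ'ᶜ ∩ Ω (j + 1)))).toFinset, ‖(ω j).2 b‖ ^ 2)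
    (h : θ.Provisos₁₃SepCoPH F N) (hθ : θ.Admissible F N) (hM₁ : 0 < θ.ν.M₁) (hle : θ.ν.M₁ ≤ θ.τ9.M) (hcR : 2 ≤ θ.s2.cR)
    (hdiv : F.L * θ.ν.M₂ ∣ θ.τ9.M) (hM3 : 3 * θ.ν.M₁ ≤ F.L * θ.ν.M₂) (hMd : 8 * F.L + 3 ≤ F.L * θ.ν.M₂)
    (hA : 0 < θ.ν.A₀) (hγ1 : θ.γ < 1) (hγp : θ.γ ≤ Real.exp (-(θ.ν.p₀ : ℝ)))
    (hg3 : (143 * ((((8 : ℕ) : ℝ)) ^ 2 / 4) ^ 2) * (θ.γ * (θ.ν.A₀ * (Real.log (θ.γ ^ 2)⁻¹) ^ θ.ν.p₀)) ≤ 1 / 3)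
    (hg2 : 2 * (θ.γ * (θ.ν.A₀ * (Real.log (θ.γ ^ 2)⁻¹) ^ θ.ν.p₀)) ≤ 2 * ExpMeanLog.deltaSU (Fin N) / (((8 * F.L : ℕ) : ℝ)) ^ 2)
    (hw : Step.InInterval θ.γ p.K (gOfRecord₁₃ F N θ.toStage13Params p)) (hPC : PartCompat₁₃ F N θ.toStage13Params p p.K)
    (hsolv : ∀ j, 1 ≤ j → j ≤ p.K → ∀ (s : SeqOfRecord F θ.ν θ.τ9.M (gOfRecord₁₃ F N θ.toStage13Params p) p.K j) (V : GaugeField (F.P p.K) j (SU N)),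
      chiSeqOfRecord F N θ.ν θ.τ9.M (gOfRecord₁₃ F N θ.toStage13Params p) p.K j s V ≠ 0 →
      ∀ a ∈ cubesIn (fun a : ↥(cubeIndices (F.P p.K) (cubeSide (F.P p.K).L θ.ν.M₂ (RkOfRecord (F.P p.K).L θ.ν.r (gOfRecord₁₃ F N θ.toStage13Params p j)) j)) =>
          cubeEnl (F.P p.K) (cubeSide (F.P p.K).L θ.ν.M₂ (RkOfRecord (F.P p.K).L θ.ν.r (gOfRecord₁₃ F N θ.toStage13Params p j)) j) a 0) (s.Ω j),
        ∃ U₀, IsMinimizer (avOfRecord F N p.K) {U | PlaqSmall (θ.ν.εreg * (F.P p.K).eta j ^ 2) U}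
          (Bj θ.ν.M₁ (cubeEnl (F.P p.K) (cubeSide (F.P p.K).L θ.ν.M₂ (RkOfRecord (F.P p.K).L θ.ν.r (gOfRecord₁₃ F N θ.toStage13Params p j)) j) a 4) j)
          (avgFamily (avOfRecord F N p.K) (qsstarGIter0 j V)) U₀)
    (σ : Sect3Supplier θ p) (hσ : SupplierObligations θ p σ) (hσB : SupplierBorel θ p σ) : SupplyChainAt θ p :=
  ⟨σ, hσ, noExpansionObligation_of_gaussCert_of_supplierBorel_of_nesting_of_scalars θ p hζ hq h hθ hM₁ hle hcR hdiv hM3 hMd hA hγ1 hγp hg3 hg2 hw hPC hsolv σ hσB⟩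

/-- **★★★★ THEOREM 1 OF [III] ALONG THE CHAIN — `∀ k ≤ K, SLaw₁₃CoPH θ p k` — AT A GAUSSIAN CERTIFICATE FROM SCALARS, `PartCompat₁₃`, K0's SOLVABILITY AND THE SUPPLIER**
(live-selector line). [cite: Balaban1988Convergent, Thm 1 p.262, Theorem p.245, §3 p.279, (3.24)–(3.25) p.270; Balaban1989LargeFieldI, (0.2)–(0.4) p.176, p.177 (i)–(ii)] -/
theorem sLaw₁₃CoPH_all_of_obligations_of_gaussCert_of_supplierBorel_of_nesting_of_scalars
    (hζ : ∀ (p' : B12.RunParams) (n : ℕ) (Ω Λ : ℕ → Set (Site (F.P p'.K) 0)), (θ.Zh p' n Ω Λ).ζ0 = (ZhPinOfRecord₁₃ θ.toStage13Params p' Ω Λ).ζ0)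
    (hq : ∀ (p' : B12.RunParams) (n : ℕ) (Ω Λ : ℕ → Set (Site (F.P p'.K) 0)) (j : ℕ) (Λ' : Set (Site (F.P p'.K) 0)) (ω : MultiCfg (F.P p'.K) (SU N) (FluctV N)),
      (θ.Zh p' n Ω Λ).quad j Λ' ω = ∑ b ∈ (Set.toFinite (bondsIn j (Λ'ᶜ ∩ Ω (j + 1)))).toFinset, ‖(ω j).2 b‖ ^ 2)
    (h : θ.Provisos₁₃SepCoPH F N)
    (hsel : θ.ppSel = ppSelLiveOfRecord F N θ.ν θ.τ9 (EOfRecord₁₃ F N θ.toStage13Params) (wOfRecord₉ F N θ.toStage9Params))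
    (hθ : θ.Admissible F N) (hκ : 0 ≤ θ.s2.lf.κ) (hE₀ : 0 ≤ θ.s2.lf.E₀) (hB₀ : 0 ≤ θ.s2.lf.B₀) (hM₁ : 0 < θ.ν.M₁) (hle : θ.ν.M₁ ≤ θ.τ9.M) (hcR : 2 ≤ θ.s2.cR)
    (hdiv : F.L * θ.ν.M₂ ∣ θ.τ9.M) (hM3 : 3 * θ.ν.M₁ ≤ F.L * θ.ν.M₂) (hMd : 8 * F.L + 3 ≤ F.L * θ.ν.M₂)
    (hA : 0 < θ.ν.A₀) (hγ1 : θ.γ < 1) (hγp : θ.γ ≤ Real.exp (-(θ.ν.p₀ : ℝ)))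
    (hg3 : (143 * ((((8 : ℕ) : ℝ)) ^ 2 / 4) ^ 2) * (θ.γ * (θ.ν.A₀ * (Real.log (θ.γ ^ 2)⁻¹) ^ θ.ν.p₀)) ≤ 1 / 3)
    (hg2 : 2 * (θ.γ * (θ.ν.A₀ * (Real.log (θ.γ ^ 2)⁻¹) ^ θ.ν.p₀)) ≤ 2 * ExpMeanLog.deltaSU (Fin N) / (((8 * F.L : ℕ) : ℝ)) ^ 2)
    (hw : Step.InInterval θ.γ p.K (gOfRecord₁₃ F N θ.toStage13Params p)) (hPC : PartCompat₁₃ F N θ.toStage13Params p p.K)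
    (hsolv : ∀ j, 1 ≤ j → j ≤ p.K → ∀ (s : SeqOfRecord F θ.ν θ.τ9.M (gOfRecord₁₃ F N θ.toStage13Params p) p.K j) (V : GaugeField (F.P p.K) j (SU N)),
      chiSeqOfRecord F N θ.ν θ.τ9.M (gOfRecord₁₃ F N θ.toStage13Params p) p.K j s V ≠ 0 →
      ∀ a ∈ cubesIn (fun a : ↥(cubeIndices (F.P p.K) (cubeSide (F.P p.K).L θ.ν.M₂ (RkOfRecord (F.P p.K).L θ.ν.r (gOfRecord₁₃ F N θ.toStage13Params p j)) j)) =>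
          cubeEnl (F.P p.K) (cubeSide (F.P p.K).L θ.ν.M₂ (RkOfRecord (F.P p.K).L θ.ν.r (gOfRecord₁₃ F N θ.toStage13Params p j)) j) a 0) (s.Ω j),
        ∃ U₀, IsMinimizer (avOfRecord F N p.K) {U | PlaqSmall (θ.ν.εreg * (F.P p.K).eta j ^ 2) U}
          (Bj θ.ν.M₁ (cubeEnl (F.P p.K) (cubeSide (F.P p.K).L θ.ν.M₂ (RkOfRecord (F.P p.K).L θ.ν.r (gOfRecord₁₃ F N θ.toStage13Params p j)) j) a 4) j)
          (avgFamily (avOfRecord F N p.K) (qsstarGIter0 j V)) U₀)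
    (σ : Sect3Supplier θ p) (hσ : SupplierObligations θ p σ) (hσB : SupplierBorel θ p σ) : ∀ k, k ≤ p.K → SLaw₁₃CoPH F N θ p k :=
  sLaw₁₃CoPH_all_of_obligations h.toCore hsel hθ hκ hE₀ hB₀ ((Nat.succ_le_of_lt hM₁).trans hle) σ hσ
    (noExpansionObligation_of_gaussCert_of_supplierBorel_of_nesting_of_scalars θ p hζ hq h hθ hM₁ hle hcR hdiv hM3 hMd hA hγ1 hγp hg3 hg2 hw hPC hsolv σ hσB)

/-- **★★★ `SupplyChainAt (gaussPinH θ) p` AT THE NAMED CERTIFICATE FROM SCALARS, `PartCompat₁₃`, K0's SOLVABILITY AND THE SUPPLIER** — NO class hypothesis.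
[cite: Balaban1988Convergent, Thm 1 p.262, Theorem p.245, §3 p.279, (3.24)–(3.25) p.270] -/
theorem supplyChainAt_gaussPinH_of_supplierBorel_of_nesting_of_scalars
    (h : θ.Provisos₁₃SepCoPH F N) (hθ : θ.Admissible F N) (hM₁ : 0 < θ.ν.M₁) (hle : θ.ν.M₁ ≤ θ.τ9.M) (hcR : 2 ≤ θ.s2.cR)
    (hdiv : F.L * θ.toStage13Params.ν.M₂ ∣ θ.toStage13Params.τ9.M) (hM3 : 3 * θ.toStage13Params.ν.M₁ ≤ F.L * θ.toStage13Params.ν.M₂) (hMd : 8 * F.L + 3 ≤ F.L * θ.toStage13Params.ν.M₂)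
    (hA : 0 < θ.toStage13Params.ν.A₀) (hγ1 : θ.toStage13Params.γ < 1) (hγp : θ.toStage13Params.γ ≤ Real.exp (-(θ.toStage13Params.ν.p₀ : ℝ)))
    (hg3 : (143 * ((((8 : ℕ) : ℝ)) ^ 2 / 4) ^ 2) * (θ.toStage13Params.γ * (θ.toStage13Params.ν.A₀ * (Real.log (θ.toStage13Params.γ ^ 2)⁻¹) ^ θ.toStage13Params.ν.p₀)) ≤ 1 / 3)
    (hg2 : 2 * (θ.toStage13Params.γ * (θ.toStage13Params.ν.A₀ * (Real.log (θ.toStage13Params.γ ^ 2)⁻¹) ^ θ.toStage13Params.ν.p₀)) ≤ 2 * ExpMeanLog.deltaSU (Fin N) / (((8 * F.L : ℕ) : ℝ)) ^ 2)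
    (hw : Step.InInterval θ.toStage13Params.γ p.K (gOfRecord₁₃ F N θ.toStage13Params p)) (hPC : PartCompat₁₃ F N θ.toStage13Params p p.K)
    (hsolv : ∀ j, 1 ≤ j → j ≤ p.K → ∀ (s : SeqOfRecord F θ.toStage13Params.ν θ.toStage13Params.τ9.M (gOfRecord₁₃ F N θ.toStage13Params p) p.K j) (V : GaugeField (F.P p.K) j (SU N)),
      chiSeqOfRecord F N θ.toStage13Params.ν θ.toStage13Params.τ9.M (gOfRecord₁₃ F N θ.toStage13Params p) p.K j s V ≠ 0 →
      ∀ a ∈ cubesIn (fun a : ↥(cubeIndices (F.P p.K) (cubeSide (F.P p.K).L θ.toStage13Params.ν.M₂ (RkOfRecord (F.P p.K).L θ.toStage13Params.ν.r (gOfRecord₁₃ F N θ.toStage13Params p j)) j)) =>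
          cubeEnl (F.P p.K) (cubeSide (F.P p.K).L θ.toStage13Params.ν.M₂ (RkOfRecord (F.P p.K).L θ.toStage13Params.ν.r (gOfRecord₁₃ F N θ.toStage13Params p j)) j) a 0) (s.Ω j),
        ∃ U₀, IsMinimizer (avOfRecord F N p.K) {U | PlaqSmall (θ.toStage13Params.ν.εreg * (F.P p.K).eta j ^ 2) U}
          (Bj θ.toStage13Params.ν.M₁ (cubeEnl (F.P p.K) (cubeSide (F.P p.K).L θ.toStage13Params.ν.M₂ (RkOfRecord (F.P p.K).L θ.toStage13Params.ν.r (gOfRecord₁₃ F N θ.toStage13Params p j)) j) a 4) j)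
          (avgFamily (avOfRecord F N p.K) (qsstarGIter0 j V)) U₀)
    (σ : Sect3Supplier (gaussPinH θ) p) (hσ : SupplierObligations (gaussPinH θ) p σ) (hσB : SupplierBorel (gaussPinH θ) p σ) : SupplyChainAt (gaussPinH θ) p :=
  supplyChainAt_of_gaussCert_of_supplierBorel_of_nesting_of_scalars (gaussPinH θ) p (gaussPinH_ζ0 θ) (gaussPinH_quad θ) (provisos₁₃SepCoPH_gaussPinH h) hθ hM₁ hle hcR
    hdiv hM3 hMd hA hγ1 hγp hg3 hg2 hw hPC hsolv σ hσ hσB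

end RunLevel

/-! ## §7  N11's PRINTED OUTPUT from scalars and, per windowed run, `PartCompat₁₃` + K0's solvability + the supplier -/

section Printed

variable (θ : Stage13HParams F N)

/-- **★★★★ `B16.Thm1Printed` AT THE K1⁷-KEYED DATUM OF A GAUSSIAN-CLASS `θ` FROM SCALARS** — FILE V §5 with the five numeric rows and the cube cover discharged run by run
(the run's window is read off the datum).  Displayed: the key, the live-selector line, `0 < M₁ ≤ M`, `2 ≤ cR`, `L·M₂ ∣ M`, `3·M₁ ≤ L·M₂`, `8L + 3 ≤ L·M₂`, `0 < A₀`,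
`θ.γ < 1`, `θ.γ ≤ e^{−p₀}`, the two edge inequalities, `0 < γ`; per run in `]0, γ]`: `PartCompat₁₃` up to `K`, K0's per-cube [15]-solvability, the supplier.
[cite: Balaban1988Convergent, Thm 1 p.262, Theorem p.245, §3 p.279, (0.2) p.244, (2.4)–(2.5) p.255; Balaban1989LargeFieldII, Thm 1 p.355; Balaban1987RG1, Thm 1 p.259; Balaban1985Variational, Thm 1 (7)–(8) pp.278–279] -/
theorem thm1Printed_datumOfRecord₁₃SepCoPH_of_gaussCert_of_supplierBorel_of_nesting_of_scalars
    (hζ : ∀ (p : B12.RunParams) (n : ℕ) (Ω Λ : ℕ → Set (Site (F.P p.K) 0)), (θ.Zh p n Ω Λ).ζ0 = (ZhPinOfRecord₁₃ θ.toStage13Params p Ω Λ).ζ0)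
    (hq : ∀ (p : B12.RunParams) (n : ℕ) (Ω Λ : ℕ → Set (Site (F.P p.K) 0)) (j : ℕ) (Λ' : Set (Site (F.P p.K) 0)) (ω : MultiCfg (F.P p.K) (SU N) (FluctV N)),
      (θ.Zh p n Ω Λ).quad j Λ' ω = ∑ b ∈ (Set.toFinite (bondsIn j (Λ'ᶜ ∩ Ω (j + 1)))).toFinset, ‖(ω j).2 b‖ ^ 2)
    (h : θ.Provisos₁₃SepCoPH F N) (hsel : θ.ppSel = ppSelLiveOfRecord F N θ.ν θ.τ9 (EOfRecord₁₃ F N θ.toStage13Params) (wOfRecord₉ F N θ.toStage9Params))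
    (hθ : θ.Admissible F N) (hκ : 0 ≤ θ.s2.lf.κ) (hE₀ : 0 ≤ θ.s2.lf.E₀) (hB₀ : 0 ≤ θ.s2.lf.B₀) (hM₁ : 0 < θ.ν.M₁) (hle : θ.ν.M₁ ≤ θ.τ9.M) (hcR : 2 ≤ θ.s2.cR)
    (hdiv : F.L * θ.ν.M₂ ∣ θ.τ9.M) (hM3 : 3 * θ.ν.M₁ ≤ F.L * θ.ν.M₂) (hMd : 8 * F.L + 3 ≤ F.L * θ.ν.M₂)
    (hA : 0 < θ.ν.A₀) (hγ1 : θ.γ < 1) (hγp : θ.γ ≤ Real.exp (-(θ.ν.p₀ : ℝ)))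
    (hg3 : (143 * ((((8 : ℕ) : ℝ)) ^ 2 / 4) ^ 2) * (θ.γ * (θ.ν.A₀ * (Real.log (θ.γ ^ 2)⁻¹) ^ θ.ν.p₀)) ≤ 1 / 3)
    (hg2 : 2 * (θ.γ * (θ.ν.A₀ * (Real.log (θ.γ ^ 2)⁻¹) ^ θ.ν.p₀)) ≤ 2 * ExpMeanLog.deltaSU (Fin N) / (((8 * F.L : ℕ) : ℝ)) ^ 2) {γ : ℝ} (hγ : 0 < γ)
    (hPC : ∀ P : B12.RunParams, Step.InInterval γ P.K (gOfRecord₁₃ F N θ.toStage13Params P) → PartCompat₁₃ F N θ.toStage13Params P P.K)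
    (hsolv : ∀ P : B12.RunParams, Step.InInterval γ P.K (gOfRecord₁₃ F N θ.toStage13Params P) → ∀ j, 1 ≤ j → j ≤ P.K →
      ∀ (s : SeqOfRecord F θ.ν θ.τ9.M (gOfRecord₁₃ F N θ.toStage13Params P) P.K j) (V : GaugeField (F.P P.K) j (SU N)),
      chiSeqOfRecord F N θ.ν θ.τ9.M (gOfRecord₁₃ F N θ.toStage13Params P) P.K j s V ≠ 0 →
      ∀ a ∈ cubesIn (fun a : ↥(cubeIndices (F.P P.K) (cubeSide (F.P P.K).L θ.ν.M₂ (RkOfRecord (F.P P.K).L θ.ν.r (gOfRecord₁₃ F N θ.toStage13Params P j)) j)) =>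
          cubeEnl (F.P P.K) (cubeSide (F.P P.K).L θ.ν.M₂ (RkOfRecord (F.P P.K).L θ.ν.r (gOfRecord₁₃ F N θ.toStage13Params P j)) j) a 0) (s.Ω j),
        ∃ U₀, IsMinimizer (avOfRecord F N P.K) {U | PlaqSmall (θ.ν.εreg * (F.P P.K).eta j ^ 2) U}
          (Bj θ.ν.M₁ (cubeEnl (F.P P.K) (cubeSide (F.P P.K).L θ.ν.M₂ (RkOfRecord (F.P P.K).L θ.ν.r (gOfRecord₁₃ F N θ.toStage13Params P j)) j) a 4) j)
          (avgFamily (avOfRecord F N P.K) (qsstarGIter0 j V)) U₀)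
    (σ : (P : B12.RunParams) → Sect3Supplier θ P) (hσ : ∀ P : B12.RunParams, Step.InInterval γ P.K (gOfRecord₁₃ F N θ.toStage13Params P) → SupplierObligations θ P (σ P))
    (hσB : ∀ P : B12.RunParams, Step.InInterval γ P.K (gOfRecord₁₃ F N θ.toStage13Params P) → SupplierBorel θ P (σ P)) :
    B16.Thm1Printed (datumOfRecord₁₃SepCoPH F N θ h).C :=
  thm1Printed_datumOfRecord₁₃CoPH_of_obligations h.toCore hsel hθ hκ hE₀ hB₀ hθ.toStage9.2.2.2 (lt_min hγ hθ.toStage9.gamma_pos) σ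
    (fun P hP => hσ P (step_inInterval_top_of_flow_inInterval_min θ h.toCore hP).1) fun P hP =>
    have hW := step_inInterval_top_of_flow_inInterval_min θ h.toCore hP
    noExpansionObligation_of_gaussCert_of_supplierBorel_of_nesting_of_scalars θ P hζ hq h hθ hM₁ hle hcR hdiv hM3 hMd hA hγ1 hγp hg3 hg2 hW.2 (hPC P hW.1)
      (hsolv P hW.1) (σ P) (hσB P hW.1)

/-- **★★★★★ `B16.Thm1Printed` AT THE K1⁷-KEYED DATUM OF THE NAMED GAUSSIAN CERTIFICATE `gaussPinH θ` FROM SCALARS — THE HONEST STATE OF N11 ON THE `SupplierBorel` ROAD.**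
Displayed EXACTLY: the key `h : θ.Provisos₁₃SepCoPH` (transferred by `provisos₁₃SepCoPH_gaussPinH`); the live-selector line of `θ` (selector clause, admissibility, three
signs); the θ-level letters `0 < M₁ ≤ M`, `2 ≤ cR`, `L·M₂ ∣ M`, `3·M₁ ≤ L·M₂`, `8L + 3 ≤ L·M₂`, `0 < A₀`, `θ.γ < 1`, `θ.γ ≤ e^{−p₀}`, `143·(8²∕4)²·ε(θ.γ) ≤ 1∕3`,
`2ε(θ.γ) ≤ 2δ_N∕(8L)²` (`ε(θ.γ) := θ.γ·A₀·(log θ.γ⁻²)^{p₀}`); SOME `γ > 0`; and PER RUN IN THE WINDOW `]0, γ]`: `PartCompat₁₃` up to `K`, K0's per-cube [15]-solvability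
inside `χ_j` at levels `1…K`, and [III] §3's supplier AT THE CERTIFICATE with `SupplierObligations` + `SupplierBorel`.  NO reading-line primitive, NO numeric row per level,
NO cube-cover row, NO class hypothesis, NO `T`-family. [cite: Balaban1988Convergent, Thm 1 p.262, Theorem p.245, §3 p.279, (0.2) p.244, (2.4)–(2.5) p.255, (3.24)–(3.25) p.270; Balaban1989LargeFieldII, Thm 1 p.355; Balaban1987RG1, Thm 1 p.259; Balaban1989LargeFieldI, (0.3)–(0.4) p.176, p.177 (i)–(ii); Balaban1985Variational, Thm 1 (7)–(8) pp.278–279] -/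
theorem thm1Printed_datumOfRecord₁₃SepCoPH_gaussPinH_of_supplierBorel_of_nesting_of_scalars
    (h : θ.Provisos₁₃SepCoPH F N) (hsel : θ.ppSel = ppSelLiveOfRecord F N θ.ν θ.τ9 (EOfRecord₁₃ F N θ.toStage13Params) (wOfRecord₉ F N θ.toStage9Params))
    (hθ : θ.Admissible F N) (hκ : 0 ≤ θ.s2.lf.κ) (hE₀ : 0 ≤ θ.s2.lf.E₀) (hB₀ : 0 ≤ θ.s2.lf.B₀) (hM₁ : 0 < θ.ν.M₁) (hle : θ.ν.M₁ ≤ θ.τ9.M) (hcR : 2 ≤ θ.s2.cR)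
    (hdiv : F.L * θ.toStage13Params.ν.M₂ ∣ θ.toStage13Params.τ9.M) (hM3 : 3 * θ.toStage13Params.ν.M₁ ≤ F.L * θ.toStage13Params.ν.M₂) (hMd : 8 * F.L + 3 ≤ F.L * θ.toStage13Params.ν.M₂)
    (hA : 0 < θ.toStage13Params.ν.A₀) (hγ1 : θ.toStage13Params.γ < 1) (hγp : θ.toStage13Params.γ ≤ Real.exp (-(θ.toStage13Params.ν.p₀ : ℝ)))
    (hg3 : (143 * ((((8 : ℕ) : ℝ)) ^ 2 / 4) ^ 2) * (θ.toStage13Params.γ * (θ.toStage13Params.ν.A₀ * (Real.log (θ.toStage13Params.γ ^ 2)⁻¹) ^ θ.toStage13Params.ν.p₀)) ≤ 1 / 3)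
    (hg2 : 2 * (θ.toStage13Params.γ * (θ.toStage13Params.ν.A₀ * (Real.log (θ.toStage13Params.γ ^ 2)⁻¹) ^ θ.toStage13Params.ν.p₀)) ≤ 2 * ExpMeanLog.deltaSU (Fin N) / (((8 * F.L : ℕ) : ℝ)) ^ 2) {γ : ℝ} (hγ : 0 < γ)
    (hPC : ∀ P : B12.RunParams, Step.InInterval γ P.K (gOfRecord₁₃ F N θ.toStage13Params P) → PartCompat₁₃ F N θ.toStage13Params P P.K)
    (hsolv : ∀ P : B12.RunParams, Step.InInterval γ P.K (gOfRecord₁₃ F N θ.toStage13Params P) → ∀ j, 1 ≤ j → j ≤ P.K →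
      ∀ (s : SeqOfRecord F θ.toStage13Params.ν θ.toStage13Params.τ9.M (gOfRecord₁₃ F N θ.toStage13Params P) P.K j) (V : GaugeField (F.P P.K) j (SU N)),
      chiSeqOfRecord F N θ.toStage13Params.ν θ.toStage13Params.τ9.M (gOfRecord₁₃ F N θ.toStage13Params P) P.K j s V ≠ 0 →
      ∀ a ∈ cubesIn (fun a : ↥(cubeIndices (F.P P.K) (cubeSide (F.P P.K).L θ.toStage13Params.ν.M₂ (RkOfRecord (F.P P.K).L θ.toStage13Params.ν.r (gOfRecord₁₃ F N θ.toStage13Params P j)) j)) =>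
          cubeEnl (F.P P.K) (cubeSide (F.P P.K).L θ.toStage13Params.ν.M₂ (RkOfRecord (F.P P.K).L θ.toStage13Params.ν.r (gOfRecord₁₃ F N θ.toStage13Params P j)) j) a 0) (s.Ω j),
        ∃ U₀, IsMinimizer (avOfRecord F N P.K) {U | PlaqSmall (θ.toStage13Params.ν.εreg * (F.P P.K).eta j ^ 2) U}
          (Bj θ.toStage13Params.ν.M₁ (cubeEnl (F.P P.K) (cubeSide (F.P P.K).L θ.toStage13Params.ν.M₂ (RkOfRecord (F.P P.K).L θ.toStage13Params.ν.r (gOfRecord₁₃ F N θ.toStage13Params P j)) j) a 4) j)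
          (avgFamily (avOfRecord F N P.K) (qsstarGIter0 j V)) U₀)
    (σ : (P : B12.RunParams) → Sect3Supplier (gaussPinH θ) P)
    (hσ : ∀ P : B12.RunParams, Step.InInterval γ P.K (gOfRecord₁₃ F N θ.toStage13Params P) → SupplierObligations (gaussPinH θ) P (σ P))
    (hσB : ∀ P : B12.RunParams, Step.InInterval γ P.K (gOfRecord₁₃ F N θ.toStage13Params P) → SupplierBorel (gaussPinH θ) P (σ P)) :
    B16.Thm1Printed (datumOfRecord₁₃SepCoPH F N (gaussPinH θ) (provisos₁₃SepCoPH_gaussPinH h)).C :=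
  thm1Printed_datumOfRecord₁₃SepCoPH_of_gaussCert_of_supplierBorel_of_nesting_of_scalars (gaussPinH θ) (gaussPinH_ζ0 θ) (gaussPinH_quad θ) (provisos₁₃SepCoPH_gaussPinH h)
    hsel hθ hκ hE₀ hB₀ hM₁ hle hcR hdiv hM3 hMd hA hγ1 hγp hg3 hg2 hγ hPC hsolv σ hσ hσB

end Printed

end Summit.QuantumFields.YangMills.Theorems.BalabanUVNodesN11Sect3SupplyChainBorelBThm1PrintedOfScalars

end
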